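import Summits.ABC.StewartYu.PadicTwistKStep
import Summits.ABC.StewartYu.DescentStepQ
import HarnessLib

/-!
# Cell abc-stewartyu, WP-Y3 (vi): the TWISTED `p`-adic descent — invariant with class, inner
# chain, composition

`Summits/ABC/StewartYu/PadicTwistMain.lean` — cell `abc-stewartyu` (seat p2; crux
`YuNinetyThreeModFour` stmt-ABC-19249, line `twist-w80`), sequel to `PadicTwistKStep.lean`.
Plain definitions and theorems; no named fact.  TWIN of p2's `PadicCW77Main.lean` for
`S : TwistSetup p`, with ONE addition: the induction invariant `Inv` is p3's sign-free
`SetupQ.Inv` (support in the box of level `J`, not all zero, `|p(u)| ≤ P`, `coreSum_{J,τ}(s) = 0` at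
the odd `s < 2ᴶ S₀`, `|τ| < T/2ᴶ`) TOGETHER WITH A CLASS: all unknowns carrying a non-zero
coefficient share one class value `ρ ∈ μ_G` [Yu 1990, (2.54), (2.65): `r₁λ₁ + ⋯ + rₙλₙ ≡ r^{(J)}`].
On a class the k-step is `padic_kstep` verbatim, so:

* `KSizes`, `KFinal` — the archimedean sizes and the numerical inequality of the inner steps, SAME
  shapes as for principal units (the twist is invisible to both);
* `kchain` — PROVED: `d` applications of `padic_kstep` at level `J`;
* `HalfStep`, `Siegel`, `Endgame` — the remaining inputs as `Prop`s on the classed invariant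
  (the half step must deliver the class at level `J+1` — the class update
  `ρ ↦ (ρ · cls₀(ε)⁻¹)^{(G+1)/2}` of `PadicTwistValues.cls_reidx`; Siegel's lemma is run on ONE class
  of the box of level `0`, price `#μ_G ≤ G` in the count; the endgame forgets the class);
* `inv_succ`, `inv_all`, `main` — PROVED compositions, verbatim.

## References
* [Yu1990] K. Yu, *Linear forms in p-adic logarithms II*, Compositio Math. 74 (1990), §§2.3–2.5.
* [Waldschmidt1980] M. Waldschmidt, Acta Arith. 37 (1980), §§3.4–3.5.
-/

noncomputable section

open NormedSpace Finset IsUltrametricDist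
open Literature.NumberTheory.Transcendental
open Literature.NumberTheory.Transcendental.PadicCW77 (condExp)
open scoped Nat

namespace Summit.ABC.StewartYu

open Literature.NumberTheory.Transcendental.CW77.Setup (Idx Tau tauNorm)

namespace TwistSetup

variable {p : ℕ} [Fact p.Prime] (S : TwistSetup p) {h Lb : ℕ}

/-! ### The invariant with class -/

/-- **The induction invariant of the twisted descent at level `J`**: p3's sign-free invariant
`SetupQ.Inv` (integers `p(u)` supported in the box of level `J`, not all zero, bounded by `P`, with
`coreSum_{J,τ}(s) = 0` for all odd `s < 2ᴶ S₀`, `|τ| < T/2ᴶ`) AND a common class value `ρ ∈ μ_G` of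
all unknowns with a non-zero coefficient. [cite: Yu1990, §2.4 (2.64)–(2.65)] -/
structure Inv (J₀ : ℕ) (L : Fin S.d → ℕ) (Lθ S₀ T : ℕ) (P : ℤ) (J : ℕ) (pv : Idx S.d h Lb → ℤ) :
    Prop where
  /-- the sign-free invariant -/
  inv : S.toQ.Inv J₀ L Lθ S₀ T P J pv
  /-- the class -/
  cls : ∃ ρ : ℚ_[p], ρ ^ S.G = 1 ∧ ∀ u, pv u ≠ 0 → S.cls u = ρ

/-! ### The inputs of the inner chain at level `J` -/

/-- **Archimedean sizes of the cores at level `J`** (same shape as `PadicCW77.Setup.KSizes`): for the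
`k`-th step (`k < d`), every `|τ| + t ≤ T/2ᴶ − k t` and odd `s₁ < 2^{k+1+J} S₀`, a denominator
`0 < D ≤ Dmax k` with `D · coreSum ∈ ℤ` and `|coreSum| ≤ Mmax k`.
[cite: Waldschmidt1980, §3.3 (3.19)–(3.21) (p. 269)] -/
def KSizes (J₀ J : ℕ) (L : Fin S.d → ℕ) (Lθ S₀ T t : ℕ) (pv : Idx S.d h Lb → ℤ)
    (Dmax Mmax : ℕ → ℝ) : Prop :=
  ∀ k, k < S.d → ∀ τ : Tau S.d, tauNorm τ + t ≤ T / 2 ^ J - k * t →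
    ∀ s₁, s₁ < 4 * (2 ^ (k + J) * S₀ / 2) → Odd s₁ →
      ∃ D : ℕ, 0 < D ∧ (D : ℝ) ≤ Dmax k ∧
        (∃ m : ℤ, (D : ℚ) * S.toQ.coreSum J₀ J (S.toQ.flat.box (h := h) (Lb := Lb) L Lθ J) pv τ s₁ = m) ∧
        |(S.toQ.coreSum J₀ J (S.toQ.flat.box (h := h) (Lb := Lb) L Lθ J) pv τ s₁ : ℝ)| ≤ Mmax k

/-- **The numerical inequality of the `k`-th step at level `J`** (same shape as
`PadicCW77.Setup.KFinal`): with `kpts = 2^{k+J} S₀ / 2` nodes of multiplicity `t`,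
`max (p^{⌊hLb/(p−1)⌋} ‖Λ₀‖ p^{⌊(t−1)/(p−1)⌋} p^{condExp p kpts t}) (p^{hLb}/(√p)^{kpts t}) < 1/(Dmax k · Mmax k)`.
[cite: Waldschmidt1980, Lemma 3.6 (p. 272)] -/
def KFinal (J : ℕ) (S₀ t : ℕ) (Dmax Mmax : ℕ → ℝ) : Prop :=
  ∀ k, k < S.d →
    max ((p : ℝ) ^ (h * Lb / (p - 1)) * ‖S.Λ₀‖ * (p : ℝ) ^ ((t - 1) / (p - 1)) *
          (p : ℝ) ^ condExp p (2 ^ (k + J) * S₀ / 2) t)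
        ((p : ℝ) ^ (h * Lb) / Real.sqrt p ^ ((2 ^ (k + J) * S₀ / 2) * t)) <
      1 / (Dmax k * Mmax k)

/-! ### The inner chain, proved -/

/-- **The inner chain at level `J`**: from the classed invariant at level `J`, for every `k ≤ d`,
`coreSum_{J,τ}(s) = 0` for odd `s < 2^{k+J} S₀` and `|τ| < T/2ᴶ − k t` (`S₀` even, `t ≥ 1`,
`(d+1) t ≤ T/2ᴶ`), by `k` applications of `padic_kstep` on the class of the invariant.
[cite: Yu1990, §2.4 Lemma 2.3] [cite: Waldschmidt1980, Lemma 3.6 (p. 272)] -/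
theorem kchain {J₀ J : ℕ} {L : Fin S.d → ℕ} {Lθ S₀ T t : ℕ} {P : ℤ} {pv : Idx S.d h Lb → ℤ}
    (inv : S.Inv J₀ L Lθ S₀ T P J pv) (hS₀ : Even S₀) (ht : 1 ≤ t)
    (htT : (S.d + 1) * t ≤ T / 2 ^ J) (hΛ : ‖S.Λ₀‖ ≤ (p : ℝ)⁻¹)
    {Dmax Mmax : ℕ → ℝ} (hsz : S.KSizes J₀ J L Lθ S₀ T t pv Dmax Mmax)
    (hfin : S.KFinal (h := h) (Lb := Lb) J S₀ t Dmax Mmax) :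
    ∀ k, k ≤ S.d → ∀ s, s < 2 ^ (k + J) * S₀ → Odd s → ∀ τ : Tau S.d,
      tauNorm τ < T / 2 ^ J - k * t →
      S.toQ.coreSum J₀ J (S.toQ.flat.box (h := h) (Lb := Lb) L Lθ J) pv τ s = 0 := by
  obtain ⟨ρ, hρG, hcls⟩ := inv.cls
  have hcls' : ∀ u ∈ S.toQ.flat.box (h := h) (Lb := Lb) L Lθ J, pv u ≠ 0 → S.cls u = ρ :=
    fun u _ hu => hcls u hu
  intro k
  induction k with
  | zero =>
    intro _ s hs hodd τ hτ
    rw [zero_add] at hs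
    exact inv.inv.rel s hs hodd τ (by simpa using hτ)
  | succ k ih =>
    intro hk s hs hodd τ hτ
    have hk' : k < S.d := by omega
    have hzero := ih hk'.le
    obtain ⟨r, hr⟩ := hS₀
    set kpts : ℕ := 2 ^ (k + J) * S₀ / 2 with hkpts
    have hkpts_eq : kpts = 2 ^ (k + J) * r := by
      rw [hkpts, hr, show 2 ^ (k + J) * (r + r) = 2 ^ (k + J) * r * 2 by ring, Nat.mul_div_cancel _ two_pos]
    have h2k : 2 * kpts = 2 ^ (k + J) * S₀ := by rw [hkpts_eq, hr]; ring
    have h4k : 4 * kpts = 2 ^ (k + 1 + J) * S₀ := by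
      rw [hkpts_eq, hr, show k + 1 + J = (k + J) + 1 by ring, pow_succ]; ring
    have hzero' : ∀ i < kpts, ∀ τ'' : Tau S.d, tauNorm τ'' < T / 2 ^ J - k * t →
        S.toQ.coreSum J₀ J (S.toQ.flat.box (h := h) (Lb := Lb) L Lθ J) pv τ'' (2 * i + 1) = 0 := by
      intro i hi τ'' hτ''
      exact hzero (2 * i + 1) (by rw [← h2k]; omega) ⟨i, by ring⟩ τ'' hτ''
    have key := S.padic_kstep J₀ J (S.toQ.flat.box (h := h) (Lb := Lb) L Lθ J) pv hcls' hρG (kpts := kpts)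
      (Tlo := T / 2 ^ J - k * t) (t := t) ht hzero' hΛ
      (Dmax := Dmax k) (Mmax := Mmax k) (hsz k hk') (hfin k hk')
    refine key s (by rw [h4k]; exact hs) hodd τ ?_
    have h2 : (k + 1) * t ≤ T / 2 ^ J :=
      le_trans (Nat.mul_le_mul_right _ (by omega)) htT
    rw [Nat.succ_mul] at hτ
    omega

/-! ### The inputs of the outer induction and the composition -/

/-- **The half step with the class update at level `J`**: from the classed invariant at level `J`
with integer bound `P` and the vanishing delivered by the inner chain (odd `s < 2^{d+J} S₀`,
`|τ| < T/2ᴶ − d t`), the classed invariant at level `J + 1` with the same bound.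
[cite: Yu1990, §2.4 Lemmas 2.4–2.5] [cite: Waldschmidt1980, Lemma 3.7 (pp. 272–273)] -/
def HalfStep (J₀ J : ℕ) (L : Fin S.d → ℕ) (Lθ S₀ T t : ℕ) (P : ℤ) : Prop :=
  ∀ pv : Idx S.d h Lb → ℤ, S.Inv J₀ L Lθ S₀ T P J pv →
    (∀ s, s < 2 ^ (S.d + J) * S₀ → Odd s → ∀ τ : Tau S.d, tauNorm τ < T / 2 ^ J - S.d * t →
      S.toQ.coreSum J₀ J (S.toQ.flat.box (h := h) (Lb := Lb) L Lθ J) pv τ s = 0) →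
    ∃ pv' : Idx S.d h Lb → ℤ, S.Inv J₀ L Lθ S₀ T P (J + 1) pv'

/-- **Level `0`: Siegel's lemma on one class** (`SetupQ.siegel_step` restricted to the unknowns of
one class value; a class with at least `#box₀/G` unknowns exists by pigeonhole over `μ_G`).
[cite: Yu1990, §2.3 Lemma 2.1] [cite: Waldschmidt1980, Lemma 3.2 (pp. 266–267)] -/
def Siegel (J₀ : ℕ) (L : Fin S.d → ℕ) (Lθ S₀ T : ℕ) (P : ℤ) : Prop :=
  ∃ pv : Idx S.d h Lb → ℤ, S.Inv J₀ L Lθ S₀ T P 0 pv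

/-- **The contradiction at the top level `J₀`** (the class is forgotten: `SetupQ.w80_endgame`).
[cite: Yu1990, §2.5] [cite: Waldschmidt1980, §3.5 (p. 274)] -/
def Endgame (J₀ : ℕ) (L : Fin S.d → ℕ) (Lθ S₀ T : ℕ) (P : ℤ) : Prop :=
  ∀ pv : Idx S.d h Lb → ℤ, S.Inv J₀ L Lθ S₀ T P J₀ pv → False

/-- **The classed invariant passes from `J` to `J + 1`**: inner chain, then the half step.
[cite: Yu1990, §2.4] [cite: Waldschmidt1980, Lemmas 3.6–3.7 (pp. 272–273)] -/
theorem inv_succ {J₀ J : ℕ} {L : Fin S.d → ℕ} {Lθ S₀ T : ℕ} {P : ℤ} {t : ℕ → ℕ}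
    (hS₀ : Even S₀) (ht : 1 ≤ t J) (htT : (S.d + 1) * t J ≤ T / 2 ^ J)
    (hΛ : ‖S.Λ₀‖ ≤ (p : ℝ)⁻¹) {Dmax Mmax : ℕ → ℕ → ℝ}
    (hsz : ∀ pv : Idx S.d h Lb → ℤ, S.Inv J₀ L Lθ S₀ T P J pv →
      S.KSizes J₀ J L Lθ S₀ T (t J) pv (Dmax J) (Mmax J))
    (hfin : S.KFinal (h := h) (Lb := Lb) J S₀ (t J) (Dmax J) (Mmax J))
    (hhalf : S.HalfStep (h := h) (Lb := Lb) J₀ J L Lθ S₀ T (t J) P)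
    {pv : Idx S.d h Lb → ℤ} (inv : S.Inv J₀ L Lθ S₀ T P J pv) :
    ∃ pv' : Idx S.d h Lb → ℤ, S.Inv J₀ L Lθ S₀ T P (J + 1) pv' :=
  hhalf pv inv (S.kchain inv hS₀ ht htT hΛ (hsz pv inv) hfin S.d le_rfl)

/-- **The classed invariant at every level `J ≤ J₀`.** [cite: Yu1990, §2.4] [cite: Waldschmidt1980, §3.4–3.5] -/
theorem inv_all {J₀ : ℕ} {L : Fin S.d → ℕ} {Lθ S₀ T : ℕ} {P : ℤ} {t : ℕ → ℕ}
    (hS₀ : Even S₀) (ht : ∀ J, J < J₀ → 1 ≤ t J)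
    (htT : ∀ J, J < J₀ → (S.d + 1) * t J ≤ T / 2 ^ J)
    (hΛ : ‖S.Λ₀‖ ≤ (p : ℝ)⁻¹) {Dmax Mmax : ℕ → ℕ → ℝ}
    (hsz : ∀ J, J < J₀ → ∀ pv : Idx S.d h Lb → ℤ, S.Inv J₀ L Lθ S₀ T P J pv →
      S.KSizes J₀ J L Lθ S₀ T (t J) pv (Dmax J) (Mmax J))
    (hfin : ∀ J, J < J₀ → S.KFinal (h := h) (Lb := Lb) J S₀ (t J) (Dmax J) (Mmax J))
    (hhalf : ∀ J, J < J₀ → S.HalfStep (h := h) (Lb := Lb) J₀ J L Lθ S₀ T (t J) P)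
    (hsiegel : S.Siegel (h := h) (Lb := Lb) J₀ L Lθ S₀ T P) :
    ∀ J, J ≤ J₀ → ∃ pv : Idx S.d h Lb → ℤ, S.Inv J₀ L Lθ S₀ T P J pv := by
  intro J
  induction J with
  | zero => intro _; exact hsiegel
  | succ J ih =>
    intro hJ
    obtain ⟨pv, inv⟩ := ih (by omega)
    have hJ' : J < J₀ := by omega
    exact S.inv_succ hS₀ (ht J hJ') (htT J hJ') hΛ (hsz J hJ') (hfin J hJ') (hhalf J hJ') inv

/-- **The twisted `p`-adic machine**: if Siegel's lemma starts the descent on a class, the sizes and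
the numerical inequalities of every inner step hold, the half steps pass the classed invariant up,
and the top level is contradictory, then the smallness hypothesis `‖Λ₀‖_p ≤ p⁻¹` is absurd.
[cite: Yu1990, Proposition 2.1] [cite: Waldschmidt1980, Prop. 3.8 and §3.5 (pp. 263, 274)] -/
theorem main {J₀ : ℕ} {L : Fin S.d → ℕ} {Lθ S₀ T : ℕ} {P : ℤ} {t : ℕ → ℕ}
    (hS₀ : Even S₀) (ht : ∀ J, J < J₀ → 1 ≤ t J)
    (htT : ∀ J, J < J₀ → (S.d + 1) * t J ≤ T / 2 ^ J)
    (hΛ : ‖S.Λ₀‖ ≤ (p : ℝ)⁻¹) {Dmax Mmax : ℕ → ℕ → ℝ}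
    (hsz : ∀ J, J < J₀ → ∀ pv : Idx S.d h Lb → ℤ, S.Inv J₀ L Lθ S₀ T P J pv →
      S.KSizes J₀ J L Lθ S₀ T (t J) pv (Dmax J) (Mmax J))
    (hfin : ∀ J, J < J₀ → S.KFinal (h := h) (Lb := Lb) J S₀ (t J) (Dmax J) (Mmax J))
    (hhalf : ∀ J, J < J₀ → S.HalfStep (h := h) (Lb := Lb) J₀ J L Lθ S₀ T (t J) P)
    (hsiegel : S.Siegel (h := h) (Lb := Lb) J₀ L Lθ S₀ T P)
    (hend : S.Endgame (h := h) (Lb := Lb) J₀ L Lθ S₀ T P) : False := by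
  obtain ⟨pv, inv⟩ := S.inv_all hS₀ ht htT hΛ hsz hfin hhalf hsiegel J₀ le_rfl
  exact hend pv inv

/-- **The endgame forgets the class**: p3's sign-free `SetupQ.w80_endgame` (Waldschmidt's asymmetric
endgame at the top level `J₀`: `L_θ < 2^{J₀}`, a multiplicity budget `T'` with
`T' + ∑ Lⱼ/2^{J₀} ≤ T/2^{J₀}` and the count `h·L_b < T' · #{odd s < 2^{J₀} S₀}`) discharges `Endgame`.
[cite: Waldschmidt1980, §3.5 (p. 274)] -/
theorem endgame_of_numbers {J₀ : ℕ} {L : Fin S.d → ℕ} {Lθ S₀ T : ℕ} {P : ℤ} {T' : ℕ}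
    (hcount : h * Lb < T' * ((range (2 ^ J₀ * S₀)).filter Odd).card) (hLθ : Lθ < 2 ^ J₀)
    (hT' : T' + ∑ j, L j / 2 ^ J₀ ≤ T / 2 ^ J₀) :
    S.Endgame (h := h) (Lb := Lb) J₀ L Lθ S₀ T P :=
  fun _ inv => S.toQ.w80_endgame inv.inv hLθ hT' hcount

end TwistSetup

end Summit.ABC.StewartYu

end
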